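import Summits.ValiantsHypothesis.ValiantsHypothesis.Theorems.ToricFixedPoints.Negative.FormDeborderingZFree
import Summits.ValiantsHypothesis.ValiantsHypothesis.Theorems.ToricFixedPoints.Negative.FormDeborderingBlockMargins

/-!
# `ToricFixedPoints` / line `form_then_lift`, stub F1: the test space of `stub_formDebordering`

Assembly of `FormDeborderingZExponent`, `FormDeborderingZFree` and `FormDeborderingBlockMargins` under
the LITERAL hypotheses of `stub_formDebordering` at `(n,m)` with `1 ≤ n < m` (F1 has `3 ≤ n ≤ m`; the
square case `n = m = 3` is `FormDeborderingMargins33`): if `F` is a coefficientwise limit of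
`c_t • P_t`, `P_t ∈ GL·det_m`, and satisfies the `H₀(n,m)`-semi-invariance hypothesis (4), then

* `F` is homogeneous of degree `m` (`isHomogeneous_of_tendsto_coeffVec_smul_glOrbit_detPoly`);
* every monomial of `F` is `z`-free, and any two monomials have the same `ℓ`-exponent and the same
  row and column sums on the block (`formDebordering_testSpace`).

I.e. `F = ℓ^a · G(Y)` with `G` a content-homogeneous form of degree `m - a` in the block variables —
Disproof §6b, now a kernel fact for all sizes.  What F1 then asserts is: every such border form is of
toric shape `a • u · top_w(g · det_m)`; true on `End·det_m` (`FormDeborderingEndType`), open exactly for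
the genuine border forms (e.g. `ℓ^{m-3}G₃`, `m ∈ {5,6}`, IF they are limits — `FormDeborderingG3NotEnd`).
Refuter/theory seat `val-width-5779-d1` (stmt-ValiantsHypothesis-5779).  VP ≠ VNP is not touched.
-/

open MvPolynomial Finset Filter
open Literature.Computability.AlgebraicComplexity

namespace Summit.ValiantsHypothesis.Cruxes.ToricFixedPoints.Negative

/-- A coefficientwise limit of forms of degree `k` is a form of degree `k`. [folklore] -/
theorem isHomogeneous_of_tendsto_coeffVec {σ : Type*} {Q : ℕ → MvPolynomial σ ℂ}
    {F : MvPolynomial σ ℂ} {k : ℕ} (hQ : ∀ t, (Q t).IsHomogeneous k)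
    (hlim : Tendsto (fun t => coeffVec (Q t)) atTop (nhds (coeffVec F))) : F.IsHomogeneous k := by
  intro γ hγ
  by_contra hne
  apply hγ
  have h := tendsto_pi_nhds.1 hlim γ
  simp only [coeffVec_apply] at h
  have h0 : (fun t => coeff γ (Q t)) = fun _ => (0 : ℂ) :=
    funext fun t => IsWeightedHomogeneous.coeff_eq_zero (hQ t) γ hne
  rw [h0] at h
  exact tendsto_nhds_unique h tendsto_const_nhds

/-- Under F1's approximation hypotheses the limit `F` is a form of degree `m`. [folklore] -/
theorem isHomogeneous_of_tendsto_coeffVec_smul_glOrbit_detPoly (m : ℕ)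
    (P : ℕ → MvPolynomial (Fin m × Fin m) ℂ) (F : MvPolynomial (Fin m × Fin m) ℂ) (c : ℕ → ℂ)
    (hP : ∀ t : ℕ, P t ∈ glOrbit (Fin m × Fin m) ℂ (detPoly (Fin m) ℂ))
    (hlim : Tendsto (fun t => coeffVec (c t • P t)) atTop (nhds (coeffVec F))) :
    F.IsHomogeneous m := by
  refine isHomogeneous_of_tendsto_coeffVec (Q := fun t => c t • P t) (fun t => ?_) hlim
  obtain ⟨A, hA⟩ := glOrbit_subset_endOrbit _ (hP t)
  have hdet : (detPoly (Fin m) ℂ).IsHomogeneous m := by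
    simpa using (detPoly_isHomogeneous (n := Fin m) (k := ℂ))
  have hPt : (P t).IsHomogeneous m := by
    rw [← hA]; exact linSubst_isHomogeneous _ hdet
  rw [smul_eq_C_mul]
  exact hPt.C_mul _

/-- **The test space of F1.**  `1 ≤ n < m`; `P, F, c` and hypotheses (1), (3), (4) of
`stub_formDebordering` at `(n,m)` verbatim (hypothesis (2) `F ≠ 0` and `3 ≤ n` are not needed).  Then
`F` is a form of degree `m`, every monomial `d ∈ supp F` vanishes at every `z`-position (outside the
block and `≠ (0,0)`), and any two monomials of `supp F` have the same `ℓ`-exponent and the same row and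
column sums in every block row / column. [folklore] -/
theorem formDebordering_testSpace (n m : ℕ) [NeZero m] (hn : 1 ≤ n) (hnm : n < m)
    (P : ℕ → MvPolynomial (Fin m × Fin m) ℂ) (F : MvPolynomial (Fin m × Fin m) ℂ) (c : ℕ → ℂ)
    (hP : ∀ t : ℕ, P t ∈ glOrbit (Fin m × Fin m) ℂ (detPoly (Fin m) ℂ))
    (hlim : Tendsto (fun t => coeffVec (c t • P t)) atTop (nhds (coeffVec F)))
    (hH : ∀ A : Matrix.GeneralLinearGroup (Fin m × Fin m) ℂ,
      let M : Matrix (Fin m × Fin m) (Fin m × Fin m) ℂ := A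
      (∀ i j : Fin m × Fin m, M j i ≠ 0 →
        (fun p : Fin m × Fin m =>
            (if (m - n ≤ (p.1 : ℕ) ∧ m - n ≤ (p.2 : ℕ)) ∨ p = (0, 0) then 0 else m * m) +
              ((p.1 : ℕ) * m + (p.2 : ℕ))) j ≤
        (fun p : Fin m × Fin m =>
            (if (m - n ≤ (p.1 : ℕ) ∧ m - n ≤ (p.2 : ℕ)) ∨ p = (0, 0) then 0 else m * m) +
              ((p.1 : ℕ) * m + (p.2 : ℕ))) i) →
      (∀ i j : Fin m × Fin m, ((m - n ≤ (i.1 : ℕ) ∧ m - n ≤ (i.2 : ℕ)) ∨ i = (0, 0)) →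
        j ≠ i → M j i = 0) →
      (∀ i k j l : Fin m, m - n ≤ (i : ℕ) → m - n ≤ (k : ℕ) → m - n ≤ (j : ℕ) → m - n ≤ (l : ℕ) →
        M (i, j) (i, j) * M (k, l) (k, l) = M (i, l) (i, l) * M (k, j) (k, j)) →
      M (0, 0) (0, 0) ^ (m - n) * ∏ i ∈ Finset.univ.filter (fun i : Fin m => m - n ≤ (i : ℕ)),
        M (i, i) (i, i) = 1 →
      ∃ e : ℂ, linSubst (Fin m × Fin m) ℂ M F = e • F) :
    F.IsHomogeneous m ∧
    ∀ d ∈ F.support, ∀ d' ∈ F.support,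
      (∀ p : Fin m × Fin m, ¬ (((m - n ≤ (p.1 : ℕ)) ∧ (m - n ≤ (p.2 : ℕ))) ∨ p = (0, 0)) → d p = 0) ∧
      d ((0 : Fin m), (0 : Fin m)) = d' ((0 : Fin m), (0 : Fin m)) ∧
      (∀ i : Fin m, m - n ≤ (i : ℕ) → ∑ j : Fin m, d (i, j) = ∑ j : Fin m, d' (i, j)) ∧
      (∀ j : Fin m, m - n ≤ (j : ℕ) → ∑ i : Fin m, d (i, j) = ∑ i : Fin m, d' (i, j)) := by
  have hF := isHomogeneous_of_tendsto_coeffVec_smul_glOrbit_detPoly m P F c hP hlim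
  refine ⟨hF, fun d hd d' hd' => ⟨fun p hp => h0_zFree n m hH p hp hd, ?_⟩⟩
  exact h0_blockMargins_eq n m hn hnm hF hH hd hd'

end Summit.ValiantsHypothesis.Cruxes.ToricFixedPoints.Negative
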